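import Mathlib
import HarnessLib
import Summits.HubbardSuperconductivity.HubbardSuperconductivity.Theorems.KLProgrammePerturbedFermiCurveLevelTowerFaaDiBruno
import Summits.HubbardSuperconductivity.HubbardSuperconductivity.Theorems.KLProgrammePerturbedFermiCurveTowerOfSizes
import Summits.HubbardSuperconductivity.HubbardSuperconductivity.Theorems.KLProgrammeH10TwoPointLimitFrameFermiPoint
import Summits.HubbardSuperconductivity.HubbardSuperconductivity.Theorems.KLProgrammeKLRegimeEngineScaleZeroE4Bands

/-!
# Route `KLProgramme` — the frame step of the curve tower at a GENERAL order `n` in `Momentum`: the rotating unit frame `toLp ∘ dir`,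
# the band sizes `‖Dᵐ e_K‖ ≤ 4 + Aₘ`, the radial slope floor, and `|u_K⁽ⁿ⁾| ≤ (n!·E_max·Gⁿ + (4 + 1/20)·Σ_{i<n} C(n,i)Rᵢ)/klCurveD`

Cell `gate-hubbard-kl`, seat hubbard-kl-k3c3-p3 (g18; row «implicit-function / monotonicity route»).  Located brick «(T)-TOWER-56» for the
(C)-closer lane (stub (C) `stub_twoLeg_curvature` of `KLRegimeEngineV17F2`, stmt-HubbardSuperconductivity-20437; c4a-1 C4A-PLAN §24.9:
«orders 3–4 at (T) wait for tables msD 5,6 / K₅,K₆»).  This module instantiates the generic level tower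
`…LevelTowerFaaDiBruno.abs_iteratedDeriv_radius_le_of_level` on the frame's Fermi curve `γ_K = u_K • (toLp ∘ dir)` at a level `ν` with the
window margins (hypotheses of `…TowerOfSizes`); the orders 5 and 6 proper are `…PerturbedFermiCurveTowerOfSizesSix`.

* §1 `hasDerivAt_toLp_dir`, `iteratedDeriv_toLp_dir` (`w⁽ᵏ⁾(ϑ) = toLp(dir(ϑ + kπ/2))`), `norm_iteratedDeriv_toLp_dir` (`= 1`), `contDiff_toLp_dir`;
  **`norm_iteratedFDeriv_frameLevel_le_four_add`** (`‖Dᵐ e_K‖ ≤ 4 + Aₘ` on `Momentum` for every `m ≥ 1` from `‖Dᵐ frameShift K‖ ≤ Aₘ` — the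
  K₅/K₆ supplier of the (T) files at `m = 5, 6`); `fderiv_frameLevel_toLp_apply_eq`, `fermiPointLp_eq_smul`, `radialSlope_momentum_ge`
  (`Dt_min − 2A ≤ De_K(γ_K(θ))[toLp dir θ]`);
* §2 **`abs_iteratedDeriv_frameRadius_le_step`** (the frame step at order `n`, any tables `R, F, Am` of lower radius jets, lower curve jets
  `F i ≤ Gⁱ`, and frame sizes with `4 + Am m ≤ E_max`), **`norm_iteratedDeriv_fermiPointLp_le_of_radius`** (`‖γ_K⁽ⁿ⁾‖ ≤ Σ_{i≤n} C(n,i) Rᵢ`).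

Everything is PROVED; no definitions; nothing about the Hubbard model's sizes; nothing asserts superconductivity.
References: BGM 2006 §2.4 Lemma 2.1 (2.40) [cite: BenfattoGiulianiMastropietro2006]; FST II CPAM 51 (1998) §3.
-/

noncomputable section

namespace Summit.HubbardSuperconductivity.HubbardSuperconductivity.Theorems.PerturbedFermiCurve

set_option linter.dupNamespace false -- summit = problem name (single-conjunct summit), D-0017

open Real Set Finset
open Literature.MathematicalPhysics.QuantumLattice Literature.MathematicalPhysics.QuantumLattice.BandSectorCounting
open Summit.HubbardSuperconductivity.HubbardSuperconductivity.Theorems.DispersionFlow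
open Summit.HubbardSuperconductivity.HubbardSuperconductivity.Theorems.KLRegimeSplit

/-! ## §1 The rotating unit frame `w = toLp ∘ dir` of `Momentum` and the band sizes on `Momentum` -/

/-- `∂_t toLp(dir t) = toLp(dir(t + π/2))`. [folklore] -/
theorem hasDerivAt_toLp_dir (ϑ : ℝ) :
    HasDerivAt (fun t : ℝ => (WithLp.toLp 2 (dir t) : Momentum)) (WithLp.toLp 2 (dir (ϑ + π / 2))) ϑ := by
  set L : (Fin 2 → ℝ) →L[ℝ] Momentum := ((EuclideanSpace.equiv (Fin 2) ℝ).symm : (Fin 2 → ℝ) →L[ℝ] Momentum) with hL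
  have hLapp : ∀ v : Fin 2 → ℝ, L v = WithLp.toLp 2 v := fun v => rfl
  have h := (L.hasFDerivAt).comp_hasDerivAt ϑ (PerturbedFermiCurve.hasDerivAt_dir ϑ)
  rw [show (fun t : ℝ => (WithLp.toLp 2 (dir t) : Momentum)) = (L : (Fin 2 → ℝ) → Momentum) ∘ dir from
    funext fun t => (hLapp _).symm, ← hLapp]
  exact h

/-- `(toLp ∘ dir)′ = toLp ∘ dir ∘ (· + π/2)`. [folklore] -/
theorem deriv_toLp_dir :
    deriv (fun t : ℝ => (WithLp.toLp 2 (dir t) : Momentum)) = fun t => WithLp.toLp 2 (dir (t + π / 2)) :=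
  funext fun t => (hasDerivAt_toLp_dir t).deriv

/-- **All derivatives of the rotating frame are rotations**: `∂ᵏ_t toLp(dir t) = toLp(dir(t + k·π/2))`. [folklore] -/
theorem iteratedDeriv_toLp_dir (k : ℕ) (ϑ : ℝ) :
    iteratedDeriv k (fun t : ℝ => (WithLp.toLp 2 (dir t) : Momentum)) ϑ = WithLp.toLp 2 (dir (ϑ + k * (π / 2))) := by
  induction k generalizing ϑ with
  | zero => simp
  | succ k ih =>
    rw [iteratedDeriv_succ', deriv_toLp_dir,
      iteratedDeriv_comp_add_const k (fun t : ℝ => (WithLp.toLp 2 (dir t) : Momentum)) (π / 2)]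
    beta_reduce
    rw [ih, show ϑ + π / 2 + (k : ℝ) * (π / 2) = ϑ + ((k + 1 : ℕ) : ℝ) * (π / 2) by push_cast; ring]

/-- `‖∂ᵏ_t toLp(dir t)‖ = 1`. [folklore] -/
theorem norm_iteratedDeriv_toLp_dir (k : ℕ) (ϑ : ℝ) : ‖iteratedDeriv k (fun t : ℝ => (WithLp.toLp 2 (dir t) : Momentum)) ϑ‖ = 1 := by
  rw [iteratedDeriv_toLp_dir, EuclideanSpace.norm_eq, Fin.sum_univ_two]
  simp only [Real.norm_eq_abs, dir_zero, dir_one, sq_abs, Real.cos_sq_add_sin_sq, Real.sqrt_one]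

/-- The rotating frame is smooth. [folklore] -/
theorem contDiff_toLp_dir {n : WithTop ℕ∞} : ContDiff ℝ n (fun t : ℝ => (WithLp.toLp 2 (dir t) : Momentum)) :=
  ((EuclideanSpace.equiv (Fin 2) ℝ).symm : (Fin 2 → ℝ) →L[ℝ] Momentum).contDiff.comp contDiff_dir

/-- **Band sizes on `Momentum`**: `‖Dᵐ e_K‖ ≤ 4 + Aₘ` from `‖Dᵐ(ε − μ)‖ ≤ 4` and `‖Dᵐ D_K‖ ≤ Aₘ` (`m ≥ 1`). -/
theorem norm_iteratedFDeriv_frameLevel_le_four_add (μ : ℝ) (K : TrigPolyC4v) {m : ℕ} (hm : 1 ≤ m) {Am : ℝ}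
    (hAm : ∀ p : Momentum, ‖iteratedFDeriv ℝ m (frameShift K) p‖ ≤ Am) (p : Momentum) :
    ‖iteratedFDeriv ℝ m (frameLevel μ K) p‖ ≤ 4 + Am := by
  have hsplit : frameLevel μ K = frameLevel μ 0 + frameShift K := by
    funext q; simp only [frameLevel, frameShift, Pi.add_apply, TrigPolyC4v.eval_zero]; ring
  rw [hsplit, iteratedFDeriv_add_apply ((EngineV8.contDiff_frameLevel μ 0).contDiffAt) ((contDiff_frameShift K).contDiffAt)]
  exact (norm_add_le _ _).trans (add_le_add (EngineV8.norm_iteratedFDeriv_frameLevel_zero_le μ hm p) (hAm p))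

/-- **The radial slope in `Momentum` coordinates**: `De_K(toLp p)[toLp v] = D(ε₀ + δ_K)(p)[v]`. -/
theorem fderiv_frameLevel_toLp_apply_eq (ν : ℝ) (K : TrigPolyC4v) (p v : Fin 2 → ℝ) :
    fderiv ℝ (frameLevel ν K) (WithLp.toLp 2 p) (WithLp.toLp 2 v) =
      fderiv ℝ (fun k : Fin 2 → ℝ => sqDispersion k + (fun k : Fin 2 → ℝ => -K.eval k) k) p v := by
  set T : (Fin 2 → ℝ) →L[ℝ] Momentum := ((EuclideanSpace.equiv (Fin 2) ℝ).symm : (Fin 2 → ℝ) →L[ℝ] Momentum) with hT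
  have hTapply : ∀ k : Fin 2 → ℝ, T k = WithLp.toLp 2 k := fun k => rfl
  have hdiff : DifferentiableAt ℝ (frameLevel ν K) (T p) :=
    ((EngineV8.contDiff_frameLevel ν K (n := 1)).differentiable one_ne_zero) _
  have hchain : fderiv ℝ (frameLevel ν K ∘ T) p = (fderiv ℝ (frameLevel ν K) (T p)).comp T :=
    (hdiff.hasFDerivAt.comp p T.hasFDerivAt).fderiv
  have happ : fderiv ℝ (frameLevel ν K) (T p) (T v) = fderiv ℝ (frameLevel ν K ∘ T) p v := by
    rw [hchain]; rfl
  have hcomp : frameLevel ν K ∘ T = fun k => (sqDispersion k + (fun k : Fin 2 → ℝ => -K.eval k) k) - ν := by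
    funext k
    simp only [Function.comp_apply, hTapply, frameLevel_toLp, frameShift_toLp]
  rw [← hTapply p, ← hTapply v, happ, hcomp, fderiv_sub_const]

/-! ## §2 The frame step at a general order `n` -/

section Sizes

variable {K : TrigPolyC4v} {A : ℝ} (hA : ∀ p : Momentum, ∀ j ≤ 2, ‖iteratedFDeriv ℝ j (frameShift K) p‖ ≤ A) (hA20 : A ≤ 1 / 20)
  (hd : klCurveD ≤ (bandBounds (show (-4 : ℝ) < -1.1 by norm_num) (show (-1.1 : ℝ) ≤ -0.1 by norm_num)
    (show (-0.1 : ℝ) < 0 by norm_num)).Dtmin - 2 * A)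
  {ν : ℝ} (hlo : (-1.1 : ℝ) ≤ ν - A) (hhi : ν + A ≤ -0.1)
include hA hA20 hd hlo hhi

omit hA hA20 hd hlo hhi in
/-- The frame's Fermi point in `Momentum` is the radius times the rotating frame: `toLp(k_F^K(ν; t)) = u_K(t) • toLp(dir t)`. -/
theorem fermiPointLp_eq_smul (t : ℝ) :
    (WithLp.toLp 2 (klFermiPoint ν K t) : Momentum) =
      perturbedFermiRadius (fun p : Fin 2 → ℝ => -K.eval p) ν t • (WithLp.toLp 2 (dir t) : Momentum) := by
  simp [klFermiPoint, WithLp.toLp_smul]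

omit hA20 hd in
/-- **The radial slope floor in `Momentum`**: `Dt_min − 2A ≤ De_K(u•toLp dir θ)[toLp dir θ]`. -/
theorem radialSlope_momentum_ge (θ : ℝ) :
    (bandBounds (show (-4 : ℝ) < -1.1 by norm_num) (show (-1.1 : ℝ) ≤ -0.1 by norm_num) (show (-0.1 : ℝ) < 0 by norm_num)).Dtmin - 2 * A ≤
      fderiv ℝ (frameLevel ν K)
        (perturbedFermiRadius (fun p : Fin 2 → ℝ => -K.eval p) ν θ • (WithLp.toLp 2 (dir θ) : Momentum))
        (WithLp.toLp 2 (dir θ)) := by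
  set B := bandBounds (show (-4 : ℝ) < -1.1 by norm_num) (show (-1.1 : ℝ) ≤ -0.1 by norm_num) (show (-0.1 : ℝ) < 0 by norm_num)
    with hBdef
  obtain ⟨hC, hδ, hκ, -, hroot⟩ := frame_band_data B hA hlo hhi
  have hfl := Dtmin_sub_le_fderiv_pertBand_dir B hδ hlo hhi hκ hroot hC θ
  rw [← WithLp.toLp_smul, fderiv_frameLevel_toLp_apply_eq]
  exact hfl

/-- **THE FRAME STEP AT ORDER `n`.**  At any level `ν` with the window margins, for a `C²`-small frame (`A ≤ 1/20`, `klCurveD ≤ Dt_min − 2A`):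
if the radius obeys `|u⁽ⁱ⁾(θ)| ≤ R i` (`i ≤ n − 1`), the Momentum curve `γ = toLp ∘ k_F^K` obeys `‖γ⁽ⁱ⁾(θ)‖ ≤ F i ≤ Gⁱ` (`1 ≤ i ≤ n − 1`,
`0 ≤ F i`, `0 ≤ G`) and the frame has `‖Dᵐ frameShift K‖ ≤ Am m` with `4 + Am m ≤ E_max` (`2 ≤ m ≤ n`), then
`|u⁽ⁿ⁾(θ)| ≤ (n!·E_max·Gⁿ + (4 + 1/20)·Σ_{i<n} C(n,i)·R i)/klCurveD` — the generic level tower `abs_iteratedDeriv_radius_le_of_level`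
with `E₁ = 4 + A`, `ρ₀ = Dt_min − 2A` relaxed. [cite: BenfattoGiulianiMastropietro2006, §2.4 Lemma 2.1 (2.40)] -/
theorem abs_iteratedDeriv_frameRadius_le_step {n : ℕ} (hn : 1 ≤ n) (θ : ℝ) {R F Am : ℕ → ℝ} {G Emax : ℝ} (hG : 0 ≤ G)
    (hEmax : 0 ≤ Emax)
    (hR : ∀ i, i ≤ n - 1 → |iteratedDeriv i (perturbedFermiRadius (fun p : Fin 2 → ℝ => -K.eval p) ν) θ| ≤ R i)
    (hF : ∀ i, 1 ≤ i → i ≤ n - 1 → ‖iteratedDeriv i (fun t : ℝ => (WithLp.toLp 2 (klFermiPoint ν K t) : Momentum)) θ‖ ≤ F i)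
    (hF0 : ∀ i, 1 ≤ i → i ≤ n - 1 → 0 ≤ F i) (hFG : ∀ i, 1 ≤ i → i ≤ n - 1 → F i ≤ G ^ i)
    (hAm : ∀ m, 2 ≤ m → m ≤ n → ∀ p : Momentum, ‖iteratedFDeriv ℝ m (frameShift K) p‖ ≤ Am m)
    (hE : ∀ m, 2 ≤ m → m ≤ n → 4 + Am m ≤ Emax) :
    |iteratedDeriv n (perturbedFermiRadius (fun p : Fin 2 → ℝ => -K.eval p) ν) θ| ≤
      (n.factorial * Emax * G ^ n + (4 + 1 / 20) * ∑ i ∈ Finset.range n, (n.choose i : ℝ) * R i) / klCurveD := by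
  set B := bandBounds (show (-4 : ℝ) < -1.1 by norm_num) (show (-1.1 : ℝ) ≤ -0.1 by norm_num) (show (-0.1 : ℝ) < 0 by norm_num)
    with hBdef
  set u := perturbedFermiRadius (fun p : Fin 2 → ℝ => -K.eval p) ν with hudef
  set w : ℝ → Momentum := fun t => WithLp.toLp 2 (dir t) with hwdef
  have hdpos : 0 < klCurveD := klCurveD_pos
  have hADt : 2 * A < B.Dtmin := by linarith
  have hρ₀ : 0 < B.Dtmin - 2 * A := by linarith
  -- smoothness
  have hu : ContDiff ℝ n u := contDiff_klFermiRadius B hA hADt hlo hhi (m := n)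
  have hw : ContDiff ℝ n w := contDiff_toLp_dir
  have he : ContDiff ℝ n (frameLevel ν K) := EngineV8.contDiff_frameLevel ν K
  -- the curve is `u • w` and lies on the level set
  have hγ : (fun t : ℝ => (WithLp.toLp 2 (klFermiPoint ν K t) : Momentum)) = fun t => u t • w t :=
    funext fun t => fermiPointLp_eq_smul t
  have hlev : ∀ t, frameLevel ν K (u t • w t) = 0 := fun t => by
    rw [← fermiPointLp_eq_smul t]; exact frameLevel_klFermiPoint B hA hlo hhi t
  -- sizes of `e`
  have hE₁ : ‖fderiv ℝ (frameLevel ν K) (u θ • w θ)‖ ≤ 4 + A := by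
    rw [norm_fderiv_eq_norm_iteratedFDeriv_one]
    exact norm_iteratedFDeriv_frameLevel_le_four_add ν K le_rfl (fun p => hA p 1 (by norm_num)) _
  have hEm : ∀ m, 2 ≤ m → m ≤ n → ‖iteratedFDeriv ℝ m (frameLevel ν K) (u θ • w θ)‖ ≤ (fun m => 4 + Am m) m :=
    fun m hm2 hmn => norm_iteratedFDeriv_frameLevel_le_four_add ν K (by omega) (hAm m hm2 hmn) _
  have hF' : ∀ i, 1 ≤ i → i ≤ n - 1 → ‖iteratedDeriv i (fun t => u t • w t) θ‖ ≤ F i := by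
    intro i hi1 hin; rw [← hγ]; exact hF i hi1 hin
  have hw1 : ∀ k, 1 ≤ k → k ≤ n → ‖iteratedDeriv k w θ‖ ≤ 1 := fun k _ _ => (norm_iteratedDeriv_toLp_dir k θ).le
  have hρ : B.Dtmin - 2 * A ≤ fderiv ℝ (frameLevel ν K) (u θ • w θ) (w θ) := radialSlope_momentum_ge hA hlo hhi θ
  -- the generic tower
  have hmain := abs_iteratedDeriv_radius_le_of_level hn hlev he hu hw hρ₀ hρ hE₁ hEm hF' hR hw1
  -- the crude closed form of the remainder and the relaxations
  have hrem := levelRemSum_le_factorial (E := fun m => 4 + Am m) (F := F) hn hEmax hG hE hF0 hFG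
  have hsum0 : 0 ≤ ∑ i ∈ Finset.range n, (n.choose i : ℝ) * R i :=
    Finset.sum_nonneg fun i hi => mul_nonneg (by positivity) ((abs_nonneg _).trans (hR i (by
      have := Finset.mem_range.1 hi; omega)))
  have hnum : (∑ c ∈ (Finset.univ : Finset (OrderedFinpartition n)).filter (fun c => c.length ≠ 1),
        (fun m => 4 + Am m) c.length * ∏ m, F (c.partSize m)) +
      (4 + A) * ∑ i ∈ Finset.range n, (n.choose i : ℝ) * R i ≤
      n.factorial * Emax * G ^ n + (4 + 1 / 20) * ∑ i ∈ Finset.range n, (n.choose i : ℝ) * R i := by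
    have h2 : (4 + A) * ∑ i ∈ Finset.range n, (n.choose i : ℝ) * R i ≤ (4 + 1 / 20) * ∑ i ∈ Finset.range n, (n.choose i : ℝ) * R i :=
      mul_le_mul_of_nonneg_right (by linarith) hsum0
    linarith
  have hpos : 0 ≤ (n.factorial : ℝ) * Emax * G ^ n + (4 + 1 / 20) * ∑ i ∈ Finset.range n, (n.choose i : ℝ) * R i := by positivity
  exact hmain.trans (div_relax hnum hpos hdpos hd)

omit hA20 in
/-- **The curve from the radius tower**: `|u⁽ⁱ⁾(θ)| ≤ R i` for `i ≤ n` ⟹ `‖γ⁽ⁿ⁾(θ)‖ ≤ Σ_{i≤n} C(n,i)·R i` (`γ = toLp ∘ k_F^K = u • w`, `‖w⁽ᵏ⁾‖ = 1`). -/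
theorem norm_iteratedDeriv_fermiPointLp_le_of_radius {n : ℕ} (θ : ℝ) {R : ℕ → ℝ}
    (hR : ∀ i, i ≤ n → |iteratedDeriv i (perturbedFermiRadius (fun p : Fin 2 → ℝ => -K.eval p) ν) θ| ≤ R i) :
    ‖iteratedDeriv n (fun t : ℝ => (WithLp.toLp 2 (klFermiPoint ν K t) : Momentum)) θ‖ ≤
      ∑ i ∈ Finset.range (n + 1), (n.choose i : ℝ) * R i := by
  set B := bandBounds (show (-4 : ℝ) < -1.1 by norm_num) (show (-1.1 : ℝ) ≤ -0.1 by norm_num) (show (-0.1 : ℝ) < 0 by norm_num)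
    with hBdef
  have hADt : 2 * A < B.Dtmin := by have := klCurveD_pos; linarith
  have hu : ContDiff ℝ n (perturbedFermiRadius (fun p : Fin 2 → ℝ => -K.eval p) ν) :=
    contDiff_klFermiRadius B hA hADt hlo hhi (m := n)
  have hγ : (fun t : ℝ => (WithLp.toLp 2 (klFermiPoint ν K t) : Momentum)) =
      fun t => perturbedFermiRadius (fun p : Fin 2 → ℝ => -K.eval p) ν t • (WithLp.toLp 2 (dir t) : Momentum) :=
    funext fun t => fermiPointLp_eq_smul t
  rw [hγ]
  exact norm_iteratedDeriv_smul_le_of_frame hu contDiff_toLp_dir θ hR fun k _ => (norm_iteratedDeriv_toLp_dir k θ).le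

end Sizes

end Summit.HubbardSuperconductivity.HubbardSuperconductivity.Theorems.PerturbedFermiCurve

end
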